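import Literature.IUT.HodgeTheaters.TemperedCoveringsSlimnessLemmas
import Literature.IUT.HodgeTheaters.TemperedCoverings
import HarnessLib

/-!
# [IUTchI] Corollary 2.3 (iii), first sentence — "`Δ̂_{X,ℍ}` is slim" — as a kernel inference over the levels `J`

Mochizuki, *Inter-universal Teichmüller theory I: construction of Hodge theaters*, kurims
manuscript (May 2020), §2, Corollary 2.3 "Subgroups of Tempered Fundamental Groups Associated to
Sub-semi-graphs", (iii) p. 47: "Suppose that [at least] one of the following conditions holds:
(a) `Σ̂` contains a prime number `l ∉ Σ ∪ {p}`; (b) `Σ̂ = 𝔓𝔯𝔦𝔪𝔢𝔰`. Then `Δ̂_{X,ℍ}` is slim", with its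
proof p. 48 l. 30 – p. 49 l. 32 ("we give, in effect, two distinct proofs of the slimness of
`Δ̂_{X,ℍ}`: one is elementary, but requires one to assume that condition (a) holds; the other depends
on the highly nontrivial theory of [Tama2] and requires one to assume that condition (b) holds")
[cite: Mochizuki2012, Cor 2.3(iii) pp.47-49] (D-0012 claim key; series status DISPUTED; nothing of
the series is asserted here).  Node `IUTchI:Cor2.3(iii)`, FIRST SENTENCE ONLY (the «in particular»
— the exact sequences `1 → Δ_{X,ℍ} → Π_{X,ℍ} → G_k → 1` of centre-free groups — is abc-iut-w4-d058's
companion `TemperedCoveringsCor23iiiProofs.lean`, p411765, whose `StableCurveTemperedData.cor23iii_of_slim`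
takes the slimness of `Δ̂_{X,ℍ}` as the hypothesis `hslim : D.Cor23Hyp → IsSlimGroup D.deltaHatH` —
exactly the type concluded by `StableCurveTemperedData.slim_of_cor23Hyp_of_levels` below; cf.
plan/GAP-LEDGER.md row G-w4d058-1, of which this file is the kernel form of the proposed disposition).

PROOF-ONLY companion of abc-iut-L5-t1's `TemperedCoverings.lean` (p405450): no new definition; the
typed field `Cor23iii.slim : D.Cor23Hyp → IsSlimGroup D.deltaHatH` is DERIVED, in the manner of
abc-iut-L5-t11's `TemperedCoveringsLevels` / `TemperedCoveringsProTree`, over the tower of normal open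
subgroups `J ⊆ Δ̂_X` from the inputs the printed proof invokes, each an explicit hypothesis stated
where the text uses it and in the data's own vocabulary (the interface `StableCurveTemperedData`
records `Δ̂_X ↠ Π̂_𝔾`, `Δ̂_{X,ℍ}` as bare data):

* B. `isSlimGroup_deltaHatH_of_levels` — the TOWER STEP (PROVED): slimness of `Δ̂_{X,ℍ}` from the
  level-wise conclusion "an `α ∈ Δ̂_X` commuting with `J ∩ Δ̂_{X,ℍ}` lies in `J`" over a cofinal family
  of normal open `J` (the text's "`J ⊆ J₀`" is absorbed by cofinality), via the toolkit's
  `isSlimGroup_subgroup_of_openNormal` and `eq_one_of_forall_mem_openNormalSubgroup`;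
* C. `mem_level_of_comm_of_inputs` — ONE LEVEL, condition (a), from the printed inputs made explicit
  per level (the vertices of the dual graph of the special fibre of the stable model of `X_J` with the
  action of `Δ̂_X`; the inverse images `P_v ⊆ J` of the verticial subgroups of `J*`, equivariant UP TO
  `J`-CONJUGACY; the decomposition groups "`J_v ⊆ J` [well-defined up to conjugation in `J`]";
  **(A3)** = [AbsTopII] Prop. 1.3 (iv) / [NodNon] Prop. 3.9 (i) at level `J` in the form the text
  uses it; the maximal pro-`l` quotients of the `J_v`; "the image of `J_v` in `Π̂_𝔾` is pro-`Σ`"; the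
  [SemiAnbd] Cor. 3.11 step; `(J*)^{ab}` with its `Δ̂_X`-action; the unipotence step; the [Config]
  Prop. 1.4 step — see its docstring); PROVED inside, not assumed: `Ker(Δ̂_X ↠ Π̂_𝔾) ⊆ Δ̂_{X,ℍ}`, (†) for
  (a) ("`J_v ∩ J_ℍ` surjects onto the maximal pro-`l` quotient of `J_v`"), "`α` fixes `v`"
  (`act_eq_of_comm`), the premise of the Cor. 3.11 step ("conjugation by `α` on the maximal pro-`l`
  quotient of `J_v` is trivial", in the form: `α` commutes with a family of elements of `J_v` mapping
  onto it), "of finite order", "unipotent of finite order, hence trivial";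
* (C′) condition (b) without (a) — NOT kernelised here: its two [Tama2] Thm. 0.2 (v) inputs ((†),
  and "since `J` and `v` … are arbitrary … `α` fixes … every closed point … hence … acts trivially")
  are CROSS-LEVEL (they consume "`α` fixes `v`" at all deeper levels at once), so a faithful rendering
  is a statement about the whole tower, left to a sequel; no typed name for [Tama2] exists in the tree
  or in plan/FACT-LIST.md and none is requested, since in the IUT application ([IUTchII] §2:
  `Σ = {l}`, `Σ̂ = 𝔓𝔯𝔦𝔪𝔢𝔰`) condition (a) holds (plan/GAP-LEDGER.md G-w4d058-1) and the elementary
  branch C is the load-bearing one — the assembly D below takes the (b)-levels' conclusions as an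
  abstract family `hB`;
* D. `slim_of_cor23Hyp_of_levels` — the first sentence in the SHAPE OF THE TYPED FIELD
  `D.Cor23Hyp → IsSlimGroup D.deltaHatH`, splitting on (a)/(b) as the text does.

Topological side conditions the interface does not record and the text uses silently: `Π̂_X`
Hausdorff and totally disconnected, `Δ̂_X` closed in `Π̂_X` (so `Δ̂_X` is profinite), `Π̂_𝔾` Hausdorff,
`Δ̂_X ↠ Π̂_𝔾` continuous.  What this file is NOT: not a discharge of the node IUTchI:Cor2.3(iii) — (A3),
the [SemiAnbd] Cor. 3.11 step, the structure of `(J*)^{ab}` (unipotence) and the [Config] Prop. 1.4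
step are merge obligations over the L3/L4 objects (stable models of the coverings `X_J`, their dual
graphs and decomposition groups), and [Tama2] Thm. 0.2 (v) is an external published input with no
typed name; the kernel check certifies that these, and nothing else, give the slimness of
`Δ̂_{X,ℍ}` AS TYPED.  Nothing here bears on [IUTchIII] Cor. 3.12; typed ≠ discharged.
-/

namespace Literature.IUT.HodgeTheaters

open Pointwise Topology
open Literature.AlgebraicGeometry.Frobenioids (IsSlimGroup)
open Literature.AnabelianGeometry.SemiGraphs (IsProSigma)

universe u

/-! ### B. The levels `J`: slimness of `Δ̂_{X,ℍ}` from the level-wise conclusion "`α ∈ J`" -/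

namespace StableCurveTemperedData

variable (D : StableCurveTemperedData.{u})

/-- `Ker(Δ̂_X ↠ Π̂_𝔾) ⊆ Δ̂_{X,ℍ}` (`Δ̂_{X,ℍ}` is the inverse image of `Π̂_ℍ ∋ 1`); the text's
"`Ker(J_v ⊆ J ⊆ Δ̂_X ↠ Π̂_𝔾) ⊆ J_v ∩ J_ℍ`" (p. 49). [cite: Mochizuki2012, Cor 2.3(iii) p.49] -/
theorem ker_ρHat_le_deltaHatH : D.ρHat.ker ≤ D.deltaHatH := fun x hx => by
  rw [deltaHatH, Subgroup.mem_comap, (MonoidHom.mem_ker).mp hx]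
  exact one_mem _

/-- **[IUTchI] Cor. 2.3 (iii), first sentence ("`Δ̂_{X,ℍ}` is slim"), the tower step** (proof,
pp. 48–49: "Let `J ⊆ Δ̂_X` be a normal open subgroup … suppose that `α ∈ Δ̂_{X,ℍ}` commutes with
`J_ℍ` … since `J` … is arbitrary, we thus conclude … that `α` is the identity element").  Over a
family of normal open subgroups `J_i ⊆ Δ̂_X` cofinal among the open normal subgroups (`hcof`; the
text's "`J ⊆ J₀`" is absorbed by cofinality), the LEVEL-WISE conclusion "an element of `Δ̂_X`
commuting with `J_i ∩ Δ̂_{X,ℍ}` lies in `J_i`" (`hlevel`, derived from the printed inputs in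
`mem_level_of_comm_of_inputs` below) gives the slimness of `Δ̂_{X,ℍ}` AS TYPED
(`IsSlimGroup D.deltaHatH`, the first field of abc-iut-L5-t1's `Cor23iii`).  Topological
side conditions not recorded by the interface: `Π̂_X` Hausdorff and totally disconnected, `Δ̂_X`
closed in `Π̂_X` (so that `Δ̂_X` is profinite). [cite: Mochizuki2012, Cor 2.3(iii) pp.48-49] -/
theorem isSlimGroup_deltaHatH_of_levels [T2Space D.PiHat] [TotallyDisconnectedSpace D.PiHat]
    (hΔc : IsClosed (D.DeltaHat : Set D.PiHat)) {I : Type*} (J : I → Subgroup D.DeltaHat)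
    (hcof : ∀ W : Subgroup D.DeltaHat, W.Normal → IsOpen (W : Set D.DeltaHat) → ∃ i, J i ≤ W)
    (hlevel : ∀ i (a : D.DeltaHat), (∀ x ∈ J i, x ∈ D.deltaHatH → a * x = x * a) → a ∈ J i) :
    IsSlimGroup D.deltaHatH := by
  haveI : CompactSpace D.DeltaHat := isCompact_iff_compactSpace.mp hΔc.isCompact
  refine isSlimGroup_subgroup_of_openNormal D.deltaHatH fun U a _ hcomm => ?_
  refine eq_one_of_forall_mem_openNormalSubgroup fun W => ?_
  haveI : (U.toSubgroup ⊓ W.toSubgroup).Normal := Subgroup.normal_inf_normal _ _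
  obtain ⟨i, hi⟩ := hcof (U.toSubgroup ⊓ W.toSubgroup) inferInstance (U.isOpen'.inter W.isOpen')
  exact (hi (hlevel i a fun x hxJ hxK => hcomm x (hi hxJ).1 hxK)).2

/-! ### C. One level `J`: "`α` commutes with `J_ℍ` ⇒ `α ∈ J`" from the printed inputs -/

/-- **"`α` fixes `v`"** (proof of [IUTchI] Cor. 2.3 (iii), p. 49 l. 19–22: "it follows by applying
either [AbsTopII], Proposition 1.3, (iv), or [NodNon], Proposition 3.9, (i), to the various
`Δ̂_X`-conjugates in `J*` of `J*_v ∩ J*_ℍ` as in (†) that the fact that `α` commutes with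
`J*_v ∩ J*_ℍ` implies that `α` fixes `v`").  Inputs, in the data's vocabulary: the vertices `v` of
the dual graph of the geometric special fibre of the stable model `𝔛_J` of `X_J` (`V`) with the action
`act` of `Δ̂_X` [through `Δ̂_X/J`]; the kernel `Ks ⊆ J` of "`J ↠ J*`, the maximal pro-`Σ*` quotient";
for each `v` the inverse image `P_v ⊆ J` of the verticial subgroup `J*_v ⊆ J*` ("well-defined up to
conjugation in `J`": `act`-equivariant UP TO `J`-CONJUGACY, `hequiv`); **(A3)** = [AbsTopII] Prop.
1.3 (iv) / [NodNon] Prop. 3.9 (i) for the pro-`Σ*` semi-graph of anabelioids `𝔾*_J` of the special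
fibre (`Π_{𝔾*_J} = J*`), in the form the text uses it — if `J`-conjugates of `P_v`, `P_w` meet in a
subgroup that is NONABELIAN modulo `Ks` [i.e. two verticial subgroups of `J*` over `v`, `w` meet in
a nonabelian subgroup] then `v = w` (`hA3`; verticial subgroups of distinct pro-vertices meet
trivially or in an (abelian) edge group, [NodNon] Lem. 1.9); and **(†)** in the currency (A3)
consumes: a decomposition group `J_v ⊆ P_v` of `v` whose subgroup `J_v ∩ Ker(J_v → Π̂_𝔾)`
[`⊆ J_v ∩ J_ℍ`] is nonabelian modulo `Ks` (`hdag`).  Conclusion: an `α ∈ Δ̂_X` commuting with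
`J ∩ Δ̂_{X,ℍ}` fixes every `v`.  (`Ker(Δ̂_X ↠ Π̂_𝔾) ⊆ Δ̂_{X,ℍ}` is `ker_ρHat_le_deltaHatH`.)
[cite: Mochizuki2012, Cor 2.3(iii) p.49] -/
theorem act_eq_of_comm (J : Subgroup D.DeltaHat)
    {V : Type*} (act : D.DeltaHat → V → V) (Ks : Subgroup D.DeltaHat)
    (Pv : V → Subgroup D.DeltaHat)
    (hequiv : ∀ (b : D.DeltaHat) (v : V), ∃ j ∈ J,
      (Pv v).map (MulAut.conj b).toMonoidHom = (Pv (act b v)).map (MulAut.conj j).toMonoidHom)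
    (hA3 : ∀ (v w : V), ∀ g ∈ J, ∀ h ∈ J,
      (∃ x ∈ (Pv v).map (MulAut.conj g).toMonoidHom ⊓ (Pv w).map (MulAut.conj h).toMonoidHom,
        ∃ y ∈ (Pv v).map (MulAut.conj g).toMonoidHom ⊓ (Pv w).map (MulAut.conj h).toMonoidHom,
          x * y * x⁻¹ * y⁻¹ ∉ Ks) → v = w)
    (Jv : V → Subgroup D.DeltaHat) (hJvP : ∀ v, Jv v ≤ Pv v) (hJvJ : ∀ v, Jv v ≤ J)
    (hdag : ∀ v, ∃ x ∈ Jv v ⊓ D.ρHat.ker, ∃ y ∈ Jv v ⊓ D.ρHat.ker, x * y * x⁻¹ * y⁻¹ ∉ Ks)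
    (a : D.DeltaHat) (ha : ∀ x ∈ J, x ∈ D.deltaHatH → a * x = x * a) (v : V) : act a v = v := by
  obtain ⟨x, ⟨hxv, hxk⟩, y, ⟨hyv, hyk⟩, hxy⟩ := hdag v
  obtain ⟨j, hjJ, hj⟩ := hequiv a v
  -- an element of `J_v ∩ Ker(Δ̂_X ↠ Π̂_𝔾)` is fixed by `α`, so lies in `P_v ∩ α P_v α⁻¹ = P_v ∩ j P_{α·v} j⁻¹`
  have hmem : ∀ z ∈ Jv v, z ∈ D.ρHat.ker →
      z ∈ (Pv v).map (MulAut.conj (1 : D.DeltaHat)).toMonoidHom ⊓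
        (Pv (act a v)).map (MulAut.conj j).toMonoidHom := by
    intro z hzv hzk
    have hc : a * z = z * a := ha z (hJvJ v hzv) (D.ker_ρHat_le_deltaHatH hzk)
    refine ⟨⟨z, hJvP v hzv, by simp⟩, ?_⟩
    rw [← hj]
    refine ⟨z, hJvP v hzv, ?_⟩
    change a * z * a⁻¹ = z
    rw [hc, mul_inv_cancel_right]
  exact (hA3 v (act a v) 1 J.one_mem j hjJ ⟨x, hmem x hxv hxk, y, hmem y hyv hyk, hxy⟩).symm

/-- **[IUTchI] Cor. 2.3 (iii), first sentence, ONE LEVEL `J`, condition (a)** (proof, p. 48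
l. 36 – p. 49 l. 32, "one is elementary, but requires one to assume that condition (a) holds").
Fix a normal open `J ⊆ Δ̂_X`; the vertices `V` of the dual graph of the special fibre of `𝔛_J`,
`act`, the kernel `Ks ⊆ J` of `J ↠ J*`, the inverse images `P_v` of the verticial subgroups
(`act`-equivariant up to `J`-conjugacy) and (A3) as in `act_eq_of_comm`; the decomposition groups
"`J_v ⊆ J` [well-defined up to conjugation in `J`] associated to `v`" (`Jv`, closed, `J_v ⊆ P_v`).
**(†), case (a)**: the prime `l ∉ Σ` (`hl`); "the maximal pro-`l` quotient of `J_v`, which is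
isomorphic to the pro-`l` completion of the fundamental group of a hyperbolic Riemann surface,
hence [as is well-known] is … nonabelian" (`L v`, `ql v` continuous surjective, pro-`l`,
nonabelian target `hLna`), "[which … is a quotient of `J*_v ∩ J*_ℍ`]" (it kills `J_v ∩ Ks`, `hqlK`);
"the image of `J_v ⊆ J ⊆ Δ̂_X ↠ Π̂_𝔾` is pro-`Σ`" (`hSigv`: the open normal subgroups of `J_v`
containing `Ker(J_v → Π̂_𝔾)` have `Σ`-index).  The **[SemiAnbd] Cor. 3.11 step**: "the fact that
conjugation by `α` on the maximal pro-`l` quotient of `J_v` [which, as we saw above, is a quotient of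
`J*_v ∩ J*_ℍ`] is trivial implies [cf. the argument concerning the inertia group "`I_v ⊆ D_v`" in …
[SemiAnbd], Corollary 3.11] that `α` not only fixes `v`, but also acts trivially on the irreducible
component … determined by `v`" (`h311`, atom `TrivOn`; its premise is supplied in the form the text
derives it: `α` commutes with a family of elements of `J_v` mapping ONTO the maximal pro-`l`
quotient); the abelianization `(J*)^{ab}` as a torsion-free abelian group `A` with the conjugation
action `ρab` of `Δ̂_X`, inner — so trivial — on `J` (`hinner`); "since `v` … is arbitrary, … `α` acts
on … `(J*)^{ab}` as a unipotent automorphism" (`hunip`); and the faithfulness step at level `J`,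
"since `J` … is arbitrary, we thus conclude [cf., e.g., the proof of [Config], Proposition 1.4]
that `α` is the identity" (`hfaith`: an element of `Δ̂_X` acting trivially on `(J*)^{ab}` lies in
`J`).  PROVED here, not assumed: (†) ("`J_v ∩ J_ℍ` … surjects onto the maximal pro-`l` quotient of
`J_v`": `map_eq_top_of_proSigma_of_proL` applied to `Ker(J_v → Π̂_𝔾) ⊆ J_v ∩ Δ̂_{X,ℍ}`), "`α` fixes
`v`" (`act_eq_of_comm`), the premise of the Cor. 3.11 step, "of finite order", "unipotent of finite
order, hence trivial" (`moduleEnd_eq_one_of_isNilpotent_sub_one_of_pow_eq_one`).  Conclusion: every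
`α ∈ Δ̂_X` commuting with `J ∩ Δ̂_{X,ℍ}` lies in `J` — the `hlevel` of
`isSlimGroup_deltaHatH_of_levels`.  Topological side conditions: `Δ̂_X` closed in `Π̂_X`, `Π̂_𝔾`
Hausdorff, `Δ̂_X ↠ Π̂_𝔾` continuous. [cite: Mochizuki2012, Cor 2.3(iii) pp.48-49] -/
theorem mem_level_of_comm_of_inputs (hΔc : IsClosed (D.DeltaHat : Set D.PiHat))
    [T2Space D.graph.Hat] (hρc : Continuous D.ρHat)
    (J : Subgroup D.DeltaHat) [J.Normal] (hJo : IsOpen (J : Set D.DeltaHat))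
    {V : Type*} (act : D.DeltaHat → V → V) (Ks : Subgroup D.DeltaHat)
    (Pv : V → Subgroup D.DeltaHat)
    (hequiv : ∀ (b : D.DeltaHat) (v : V), ∃ j ∈ J,
      (Pv v).map (MulAut.conj b).toMonoidHom = (Pv (act b v)).map (MulAut.conj j).toMonoidHom)
    (hA3 : ∀ (v w : V), ∀ g ∈ J, ∀ h ∈ J,
      (∃ x ∈ (Pv v).map (MulAut.conj g).toMonoidHom ⊓ (Pv w).map (MulAut.conj h).toMonoidHom,
        ∃ y ∈ (Pv v).map (MulAut.conj g).toMonoidHom ⊓ (Pv w).map (MulAut.conj h).toMonoidHom,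
          x * y * x⁻¹ * y⁻¹ ∉ Ks) → v = w)
    (Jv : V → Subgroup D.DeltaHat) (hJvP : ∀ v, Jv v ≤ Pv v) (hJvJ : ∀ v, Jv v ≤ J)
    (hJvc : ∀ v, IsClosed (Jv v : Set D.DeltaHat))
    {l : ℕ} (hl : l ∉ D.graph.Sigma)
    (L : V → Type*) [∀ v, Group (L v)] [∀ v, TopologicalSpace (L v)]
    [∀ v, IsTopologicalGroup (L v)] [∀ v, CompactSpace (L v)]
    [∀ v, TotallyDisconnectedSpace (L v)] [∀ v, T2Space (L v)]
    (ql : ∀ v, Jv v →* L v) (hqlc : ∀ v, Continuous (ql v))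
    (hqls : ∀ v, Function.Surjective (ql v)) (hLl : ∀ v, IsProSigma {l} (L v))
    (hLna : ∀ v, ∃ X Y : L v, X * Y ≠ Y * X)
    (hqlK : ∀ v (x : Jv v), (x : D.DeltaHat) ∈ Ks → ql v x = 1)
    (hSigv : ∀ (v : V) (M : Subgroup (Jv v)), M.Normal → IsOpen (M : Set (Jv v)) →
      (D.ρHat.ker).subgroupOf (Jv v) ≤ M → ∀ p : ℕ, p.Prime → p ∣ M.index → p ∈ D.graph.Sigma)
    (TrivOn : D.DeltaHat → V → Prop)
    (h311 : ∀ (b : D.DeltaHat) (v : V), act b v = v →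
      (∀ X : L v, ∃ x : Jv v, ql v x = X ∧ b * (x : D.DeltaHat) * b⁻¹ = x) → TrivOn b v)
    {A : Type*} [AddCommGroup A] [IsAddTorsionFree A] (ρab : D.DeltaHat →* Module.End ℤ A)
    (hinner : J ≤ ρab.ker)
    (hunip : ∀ b : D.DeltaHat, (∀ v, act b v = v ∧ TrivOn b v) → IsNilpotent (ρab b - 1))
    (hfaith : ∀ b : D.DeltaHat, ρab b = 1 → b ∈ J)
    (a : D.DeltaHat) (ha : ∀ x ∈ J, x ∈ D.deltaHatH → a * x = x * a) : a ∈ J := by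
  haveI : CompactSpace D.DeltaHat := isCompact_iff_compactSpace.mp hΔc.isCompact
  -- `a` commutes with every element of `J_v ∩ Ker(Δ̂_X ↠ Π̂_𝔾) ⊆ J ∩ Δ̂_{X,ℍ}`, in conjugation form
  have hconj : ∀ v (h : Jv v), (h : D.DeltaHat) ∈ D.ρHat.ker →
      a * (h : D.DeltaHat) * a⁻¹ = h := by
    intro v h hh
    rw [ha h (hJvJ v h.2) (D.ker_ρHat_le_deltaHatH hh), mul_inv_cancel_right]
  -- (†), case (a): `N_v := Ker(J_v → Π̂_𝔾)` maps ONTO the maximal pro-`l` quotient `L v`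
  have hN : ∀ v, ((D.ρHat.ker).subgroupOf (Jv v)).map (ql v) = ⊤ := by
    intro v
    haveI : CompactSpace (Jv v) := isCompact_iff_compactSpace.mp (hJvc v).isCompact
    refine map_eq_top_of_proSigma_of_proL hl _ (hSigv v) (ql v) (hqlc v) (hqls v) (hLl v) ?_
    have hkc : IsClosed ((D.ρHat.ker : Subgroup D.DeltaHat) : Set D.DeltaHat) := by
      have e : ((D.ρHat.ker : Subgroup D.DeltaHat) : Set D.DeltaHat) = D.ρHat ⁻¹' {1} := by
        ext x; exact MonoidHom.mem_ker
      rw [e]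
      exact isClosed_singleton.preimage hρc
    have hc : IsCompact (((D.ρHat.ker).subgroupOf (Jv v) : Subgroup (Jv v)) : Set (Jv v)) :=
      (hkc.preimage continuous_subtype_val).isCompact
    rw [Subgroup.coe_map]
    exact (hc.image (hqlc v)).isClosed
  -- every element of `L v` lifts to `N_v`
  have hlift : ∀ v (X : L v), ∃ h : Jv v, (h : D.DeltaHat) ∈ D.ρHat.ker ∧ ql v h = X := by
    intro v X
    have hX : X ∈ ((D.ρHat.ker).subgroupOf (Jv v)).map (ql v) := by rw [hN v]; trivial
    obtain ⟨h, hh, rfl⟩ := Subgroup.mem_map.mp hX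
    exact ⟨h, Subgroup.mem_subgroupOf.mp hh, rfl⟩
  -- (†) in the currency of (A3): `N_v` is nonabelian modulo `Ks`
  have hdag : ∀ v, ∃ x ∈ Jv v ⊓ D.ρHat.ker, ∃ y ∈ Jv v ⊓ D.ρHat.ker,
      x * y * x⁻¹ * y⁻¹ ∉ Ks := by
    intro v
    obtain ⟨X, Y, hXY⟩ := hLna v
    obtain ⟨x, hxk, rfl⟩ := hlift v X
    obtain ⟨y, hyk, rfl⟩ := hlift v Y
    refine ⟨x, ⟨x.2, hxk⟩, y, ⟨y.2, hyk⟩, fun hK => hXY ?_⟩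
    have h1 : ql v (x * y * x⁻¹ * y⁻¹) = 1 := hqlK v _ (by simpa using hK)
    rw [map_mul, map_mul, map_mul, map_inv, map_inv, mul_inv_eq_one, mul_inv_eq_iff_eq_mul] at h1
    exact h1
  -- Step 1 ("`α` fixes `v`") and Step 2 (the premise of the [SemiAnbd] Cor. 3.11 step)
  have hfix : ∀ v, act a v = v :=
    D.act_eq_of_comm J act Ks Pv hequiv hA3 Jv hJvP hJvJ hdag a ha
  have htriv : ∀ v (X : L v), ∃ x : Jv v, ql v x = X ∧ a * (x : D.DeltaHat) * a⁻¹ = x := by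
    intro v X
    obtain ⟨h, hhk, hhx⟩ := hlift v X
    exact ⟨h, hhx, hconj v h hhk⟩
  -- Step 3: trivial on every component ⇒ unipotent of finite order on `(J*)^{ab}` ⇒ trivial ⇒ `a ∈ J`
  have hnil : IsNilpotent (ρab a - 1) :=
    hunip a fun v => ⟨hfix v, h311 a v (hfix v) (htriv v)⟩
  haveI : Finite (D.DeltaHat ⧸ J) := Subgroup.quotient_finite_of_isOpen J hJo
  have hpow : ρab a ^ J.index = 1 := by
    rw [← map_pow]
    exact (MonoidHom.mem_ker).mp (hinner (J.pow_index_mem a))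
  exact hfaith a
    (moduleEnd_eq_one_of_isNilpotent_sub_one_of_pow_eq_one hnil J.index_ne_zero_of_finite hpow)

/-! ### D. The first sentence of Cor. 2.3 (iii) in the shape of the typed field `Cor23iii.slim` -/

/-- **[IUTchI] Cor. 2.3 (iii), first sentence, AS THE FIELD `Cor23iii.slim` of abc-iut-L5-t1's
predicate** ("Suppose that [at least] one of the following conditions holds: (a) `Σ̂` contains a
prime number `l ∉ Σ ∪ {p}`; (b) `Σ̂ = 𝔓𝔯𝔦𝔪𝔢𝔰`. Then `Δ̂_{X,ℍ}` is slim", p. 47): from the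
level-wise conclusions "`α` commutes with `J ∩ Δ̂_{X,ℍ}` ⇒ `α ∈ J`" over a cofinal family of normal
open `J ⊆ Δ̂_X`, supplied under (a) (`hA`, from `mem_level_of_comm_of_inputs` at each level) and
under (b) (`hB`, an abstract family here — see the module docstring, (C′)), exactly as the printed
proof splits ("If condition (a) holds … If condition (b) holds, but condition (a) does not hold …",
p. 48).  The
consumer is the «in particular» of Cor. 2.3 (iii) (exact sequences of centre-free groups; seat
abc-iut-w4-d058), whose slimness hypothesis has precisely this type.
[cite: Mochizuki2012, Cor 2.3(iii) pp.47-49] -/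
theorem slim_of_cor23Hyp_of_levels [T2Space D.PiHat] [TotallyDisconnectedSpace D.PiHat]
    (hΔc : IsClosed (D.DeltaHat : Set D.PiHat)) {I : Type*} (J : I → Subgroup D.DeltaHat)
    (hcof : ∀ W : Subgroup D.DeltaHat, W.Normal → IsOpen (W : Set D.DeltaHat) → ∃ i, J i ≤ W)
    (hA : (∃ l ∈ D.graph.SigmaHat, l ∉ D.graph.Sigma ∧ l ≠ D.p) →
      ∀ i (a : D.DeltaHat), (∀ x ∈ J i, x ∈ D.deltaHatH → a * x = x * a) → a ∈ J i)
    (hB : D.graph.SigmaHat = {q | q.Prime} →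
      ∀ i (a : D.DeltaHat), (∀ x ∈ J i, x ∈ D.deltaHatH → a * x = x * a) → a ∈ J i) :
    D.Cor23Hyp → IsSlimGroup D.deltaHatH := fun hyp =>
  hyp.out.elim (fun ha => D.isSlimGroup_deltaHatH_of_levels hΔc J hcof (hA ha))
    fun hb => D.isSlimGroup_deltaHatH_of_levels hΔc J hcof (hB hb)

end StableCurveTemperedData

end Literature.IUT.HodgeTheaters
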